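import Literature.NumberTheory.Automorphic.ReciprocityGLn
import Literature.NumberTheory.EllipticCurves.SupersingularDivisionPolynomialProofs
import Literature.NumberTheory.EllipticCurves.PointCountHasseInvariantProofs
import HarnessLib

/-!
# Good ordinary reduction data at a place above `ℓ` from `Δ(E mod v) ≠ 0` and `ℓ ∤ a_v(E)`
(route `SkinnerWilesDefectOne`, item stmt-Langlands-12922 `FiveIsogenyEllipticCurves`, helper)

The headline corollary phrases "good ordinary reduction at `v ∣ 5`" for an integral Weierstrass
model `E` over `𝓞 F` as `(E mod v).Δ ≠ 0 ∧ ¬ 5 ∣ a_v(E)` with the point-count trace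
`a_v(E) = q_v + 1 - #E(k_v)` (`Literature.NumberTheory.Automorphic.frobTraceAt`).  The tree's
local input at an ordinary place above `ℓ` (`WeierstrassCurve.card_map_smul_sub_geomTorsion_le_pow`,
Serre 1968 IV A.2.2) wants instead a model `M` over `𝒪_v` with unit discriminant and unit Hasse
invariant `A_ℓ(M)` (`WeierstrassCurve.hasseCoeff`).  This file converts: `M = E ⊗ 𝒪_v`
(`isUnit_Δ_map_adicCompletionIntegers`, `isUnit_hasseCoeff_map_adicCompletionIntegers`), through
Silverman, *AEC*, V.4.1(a) — `a_q ≡ A_q (mod p)` over the finite residue field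
(`cast_card_add_one_sub_natCard_point`) and `A_p = 0 ⇒ A_{p^r} = 0`
(`hasseCoeff_prime_pow_eq_zero`) — in the form `hasseCoeff_ne_zero_of_not_dvd`.

References: J. H. Silverman, *The Arithmetic of Elliptic Curves* (2009), Thm. V.4.1(a) and
Ex. 5.10 (supersingular iff `p ∣ a_q`); J.-P. Serre, *Abelian ℓ-adic representations* (1968),
IV A.2.2.
-/

noncomputable section

-- `Summit.Langlands.Langlands.…`: summit = sub-problem name (D-0017 layout), as in every Theorems file here.
set_option linter.dupNamespace false

open scoped NumberField Classical
open IsDedekindDomain NumberField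
open Literature.NumberTheory.Automorphic

namespace Summit.Langlands.Langlands.Theorems.FiveIsogenyEllipticCurves

/-! ### Finite fields: `p ∤ a_q ⇒ A_p ≠ 0` -/

section FiniteField

variable {k : Type*} [Field k] [Finite k] (V : WeierstrassCurve k) [V.IsElliptic] (p : ℕ)
  [hp : Fact p.Prime] [CharP k p]

/-- **Ordinary means unit Hasse invariant.**  For an elliptic curve `V` over a finite field `k` of
odd characteristic `p` with `p ∤ a = #k + 1 - #V(k)`, the Hasse invariant `A_p(V)`
(`hasseCoeff p`) is non-zero: otherwise `A_q = 0` for `q = #k = p^r`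
(`hasseCoeff_prime_pow_eq_zero`) and `a = A_q = 0` in `k` (Silverman V.4.1(a),
`cast_card_add_one_sub_natCard_point`), i.e. `p ∣ a`. [cite: SilvermanAEC2009, V.4.1] -/
theorem hasseCoeff_ne_zero_of_not_dvd (hp2 : p ≠ 2)
    (ha : ¬ (p : ℤ) ∣ (Nat.card k : ℤ) + 1 - Nat.card V.toAffine.Point) :
    V.hasseCoeff p ≠ 0 := by
  intro hA
  letI : Fintype k := Fintype.ofFinite k
  obtain ⟨n, hpchar, hn⟩ := FiniteField.card k p
  have h2 : ringChar k ≠ 2 := by rw [ringChar.eq k p]; exact hp2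
  have hq : V.hasseCoeff (Fintype.card k) = 0 := by
    rw [hn]
    exact V.hasseCoeff_prime_pow_eq_zero p hp2 hA n.pos
  have hcast := V.cast_card_add_one_sub_natCard_point h2
  change (((Fintype.card k : ℤ) + 1 - Nat.card V.toAffine.Point : ℤ) : k) =
    V.hasseCoeff (Fintype.card k) at hcast
  rw [hq, CharP.intCast_eq_zero_iff k p, ← Nat.card_eq_fintype_card] at hcast
  exact ha hcast

end FiniteField

/-! ### Integral models over `𝓞 F` at a place `v` -/

section IntegralModel

variable {F : Type} [Field F] [NumberField F] (E : WeierstrassCurve (𝓞 F))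
  (v : HeightOneSpectrum (𝓞 F))

/-- An element of `𝓞 F` outside `v` is a unit of the completed ring of integers `𝒪_v`. [folklore] -/
theorem isUnit_algebraMap_adicCompletionIntegers_of_not_mem {r : 𝓞 F} (hr : r ∉ v.asIdeal) :
    IsUnit (algebraMap (𝓞 F) (v.adicCompletionIntegers F) r) := by
  rw [HeightOneSpectrum.adicCompletionIntegers.isUnit_iff_valued_eq_one,
    HeightOneSpectrum.algebraMap_adicCompletionIntegers_apply,
    HeightOneSpectrum.valuedAdicCompletion_eq_valuation',
    HeightOneSpectrum.valuation_of_algebraMap, HeightOneSpectrum.intValuation_eq_one_iff]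
  exact hr

/-- **Unit discriminant of `E ⊗ 𝒪_v` from `Δ(E mod v) ≠ 0`.** [folklore] -/
theorem isUnit_Δ_map_adicCompletionIntegers
    (hΔ : (E.map (Ideal.Quotient.mk v.asIdeal)).Δ ≠ 0) :
    IsUnit (E.map (algebraMap (𝓞 F) (v.adicCompletionIntegers F))).Δ := by
  rw [WeierstrassCurve.map_Δ]
  refine isUnit_algebraMap_adicCompletionIntegers_of_not_mem v fun hmem => hΔ ?_
  rw [WeierstrassCurve.map_Δ, Ideal.Quotient.eq_zero_iff_mem]
  exact hmem

omit [NumberField F] in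
/-- `Δ(E mod v) ≠ 0` says `Δ(E) ∉ v`. [folklore] -/
theorem Δ_not_mem_of_map_Δ_ne_zero (hΔ : (E.map (Ideal.Quotient.mk v.asIdeal)).Δ ≠ 0) :
    E.Δ ∉ v.asIdeal := by
  intro hmem
  apply hΔ
  rw [WeierstrassCurve.map_Δ, Ideal.Quotient.eq_zero_iff_mem]
  exact hmem

/-- **Unit Hasse invariant of `E ⊗ 𝒪_v` from `ℓ ∤ a_v(E)`.**  For an odd prime `ℓ`, a place
`v ∣ ℓ` with `Δ(E mod v) ≠ 0` and `ℓ ∤ a_v(E) = q_v + 1 - #E(k_v)` (`frobTraceAt`), the Hasse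
invariant `A_ℓ(E ⊗ 𝒪_v)` is a unit of `𝒪_v`: its residue is `A_ℓ(E mod v) ≠ 0`
(`hasseCoeff_ne_zero_of_not_dvd` over the finite field `k_v = 𝓞 F ⧸ v` of characteristic `ℓ`).
[cite: SilvermanAEC2009, V.4.1] -/
theorem isUnit_hasseCoeff_map_adicCompletionIntegers {ℓ : ℕ} [hℓ : Fact ℓ.Prime] (hℓ2 : ℓ ≠ 2)
    (hℓv : (ℓ : 𝓞 F) ∈ v.asIdeal) (hΔ : (E.map (Ideal.Quotient.mk v.asIdeal)).Δ ≠ 0)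
    (ha : ¬ (ℓ : ℤ) ∣ frobTraceAt E v) :
    IsUnit ((E.map (algebraMap (𝓞 F) (v.adicCompletionIntegers F))).hasseCoeff ℓ) := by
  rw [WeierstrassCurve.map_hasseCoeff]
  refine isUnit_algebraMap_adicCompletionIntegers_of_not_mem v fun hmem => ?_
  -- the residue field `k = 𝓞 F ⧸ v`: finite of characteristic `ℓ`
  haveI : v.asIdeal.IsMaximal := v.isMaximal
  letI : Field (𝓞 F ⧸ v.asIdeal) := Ideal.Quotient.field v.asIdeal
  haveI : Finite (𝓞 F ⧸ v.asIdeal) := Ideal.finiteQuotientOfFreeOfNeBot v.asIdeal v.ne_bot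
  have hℓk : (ℓ : 𝓞 F ⧸ v.asIdeal) = 0 := by
    rw [← map_natCast (Ideal.Quotient.mk v.asIdeal), Ideal.Quotient.eq_zero_iff_mem]
    exact hℓv
  haveI : CharP (𝓞 F ⧸ v.asIdeal) ℓ := (CharP.charP_iff_prime_eq_zero hℓ.out).mpr hℓk
  haveI : (E.map (Ideal.Quotient.mk v.asIdeal)).IsElliptic := by
    rw [WeierstrassCurve.isElliptic_iff]
    exact (isUnit_iff_ne_zero (a := (E.map (Ideal.Quotient.mk v.asIdeal)).Δ)).mpr fun h => hΔ h
  have hA : (E.map (Ideal.Quotient.mk v.asIdeal)).hasseCoeff ℓ = 0 := by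
    rw [WeierstrassCurve.map_hasseCoeff, Ideal.Quotient.eq_zero_iff_mem]
    exact hmem
  refine hasseCoeff_ne_zero_of_not_dvd (E.map (Ideal.Quotient.mk v.asIdeal)) ℓ hℓ2 ?_ hA
  -- `a_v(E) = #k + 1 - #E(k)`
  rw [← HeightOneSpectrum.residueCard_eq_card_quotient]
  simpa only [frobTraceAt, numPointsResidue] using ha

end IntegralModel

end Summit.Langlands.Langlands.Theorems.FiveIsogenyEllipticCurves

end
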